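import Summits.BirchSwinnertonDyer.BirchSwinnertonDyer.Theorems.ResidualThetaTransportAtTwoThetaLayerLambdaCongruenceAtTwoStarLevel
import Literature.NumberTheory.EllipticCurves.ModularJacobianModTwoMultiplicityOne
import Literature.NumberTheory.EllipticCurves.SupersingularModPDecompositionImage
import Literature.NumberTheory.Automorphic.BCDTModularityModPProofs
import Literature.NumberTheory.EllipticCurves.HasseWeilGoodReductionProofs
import Literature.NumberTheory.EllipticCurves.LFunctionPrimeCoeff
import Literature.NumberTheory.GaloisRepresentations.GoodDihedralLocalImage
import Literature.Computability.AlgebraicComplexity.SchemeSymmetryGroupOrderF2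
import Mathlib.FieldTheory.IsAlgClosed.AlgebraicClosure
import HarnessLib

/-!
# Crux `ThetaLayerLambdaCongruenceAtTwo`, line `birth`, stub (C3k): the Galois side of ITEM B4
# (the hypotheses of Buzzard's mod-`2` multiplicity one at the eigen-ideal of `W`)

Helper file for `stmt-BirchSwinnertonDyer-20688` (no definition, no new obligation).  `StarLevel.kTwo_of_dvd`
proves the lead's (K2) from four named facts and ONE input `hsub = dim_{𝕋/𝔪₀} J₀(L)[𝔪₀] = 2`, the conclusion
of `buzzard2000_multiplicityOne_gamma0` at the explicit eigen-ideal `𝔪₀`.  This file discharges the Galois-side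
hypotheses of that fact for a curve `W/ℚ` with good supersingular reduction at `2`:

* §0  `|GL₂(𝔽₂)| = 6` (tree: `card_GL_fin_two_zmod_two`); the two transvections `(1 1; 0 1)`, `(1 0; 1 1)` have no common eigenvector over any
  field; places of `ℚ` and primes.
* §1  `map_decompositionSubgroup_eq_top_of_goodSS_two`: by Serre's Prop. 12 (the named fact
  `serre1972_supersingular_decompositionSubgroup_image` at `p = 2`: `|ρ̄(D_𝔓)| = 2·(2² - 1) = 6`) the
  decomposition group at any `𝔓 ∣ 2` maps ONTO `GL₂(𝔽₂)` under the mod-`2` representation `ρ̄ = ρ̄_{W,2}`.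
* §2  `finrank_torsionBySet_eq_two_of_facts`: for `L` odd, every prime `p ∤ 2L` good for `W`, and a maximal
  ideal `𝔪 ∋ 2` of `𝕋 = HeckeRing0 L 2` with `|𝕋/𝔪| = 2` and `T_q ≡ a_q(W) (mod 𝔪)` for `q ∤ L`:
  `dim_{𝕋/𝔪} J₀(L)[𝔪] = 2`, from `buzzard2000_multiplicityOne_gamma0` applied to `k = 𝔽̄₂` (discrete),
  `ι : 𝕋/𝔪 ≅ 𝔽₂ → k`, `ρ = ρ̄_{W,2} ⊗ k` (`exists_isTorsionGaloisRep`, `FramedRep.baseChange`): unramified with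
  Frobenius polynomial `X² - a_p X + p ≡ X² - T_p X + p` at `p ∤ 2L` (`isUnramifiedAt_of_hasGoodReductionAt`,
  `charpoly_eq_of_isArithFrobAt`, `lFunction_primesEquiv_eq_frobeniusTraceAt`), irreducible over `k` (the image
  contains both transvections, §0–§1) and non-scalar on `D₂` (it contains `(1 1; 0 1)`).
* §3  `kTwo_of_dvd_of_facts`: (K2) at the crux's level from the named facts alone (no `hsub`): if `𝔪₀ = ⊤` the
  statement is vacuous (`K ⊇ 𝔪₀Λ = Λ`), otherwise `𝔪₀` is maximal with `|𝕋/𝔪₀| = 2` (`StarKTwoOfFacts`) and §2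
  supplies `hsub`.

What then remains of (C3k) is the lead's reduction (K2) → (C3k) (`…PlusLineReduction`).  BSD is not proved by any of
this.
-/

noncomputable section

-- justification: the `Summit.BirchSwinnertonDyer.BirchSwinnertonDyer.…` path repeats a component (route-file convention)
set_option linter.dupNamespace false

open scoped MatrixGroups ModularForm NumberField

open CongruenceSubgroup Polynomial IsDedekindDomain Field Matrix WeierstrassCurve
open Literature.NumberTheory.EllipticCurves Literature.NumberTheory.EllipticCurves.ModularForms
open Literature.NumberTheory.EllipticCurves.Rank1Residual Literature.NumberTheory.GaloisRepresentations
open Rat.HeightOneSpectrum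

namespace Summit.BirchSwinnertonDyer.BirchSwinnertonDyer.Theorems.ThetaLayerLambdaCongruenceAtTwo

/-! ## §0 Linear algebra in `GL₂(𝔽₂)` and places of `ℚ` -/

section LinearAlgebra

/-- The upper transvection `(1 1; 0 1)` is invertible over any commutative ring. [folklore] -/
theorem exists_GL_coe_eq_upperTransvection (R : Type*) [CommRing R] :
    ∃ g : GL (Fin 2) R, (g : Matrix (Fin 2) (Fin 2) R) = !![(1 : R), 1; 0, 1] :=
  ⟨⟨!![1, 1; 0, 1], !![1, -1; 0, 1], by ext i j; fin_cases i <;> fin_cases j <;> simp,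
    by ext i j; fin_cases i <;> fin_cases j <;> simp⟩, rfl⟩

/-- The lower transvection `(1 0; 1 1)` is invertible over any commutative ring. [folklore] -/
theorem exists_GL_coe_eq_lowerTransvection (R : Type*) [CommRing R] :
    ∃ g : GL (Fin 2) R, (g : Matrix (Fin 2) (Fin 2) R) = !![(1 : R), 0; 1, 1] :=
  ⟨⟨!![1, 0; 1, 1], !![1, 0; -1, 1], by ext i j; fin_cases i <;> fin_cases j <;> simp,
    by ext i j; fin_cases i <;> fin_cases j <;> simp⟩, rfl⟩

/-- The image of `(1 1; 0 1)` under any ring map is `(1 1; 0 1)`. [folklore] -/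
theorem map_upperTransvection {R S : Type*} [CommRing R] [CommRing S] (f : R →+* S) :
    (!![(1 : R), 1; 0, 1]).map f = !![(1 : S), 1; 0, 1] := by
  ext i j; fin_cases i <;> fin_cases j <;> simp

/-- The image of `(1 0; 1 1)` under any ring map is `(1 0; 1 1)`. [folklore] -/
theorem map_lowerTransvection {R S : Type*} [CommRing R] [CommRing S] (f : R →+* S) :
    (!![(1 : R), 0; 1, 1]).map f = !![(1 : S), 0; 1, 1] := by
  ext i j; fin_cases i <;> fin_cases j <;> simp

/-- **The two transvections have no common eigenvector** over any field: a simultaneous eigenvector of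
`(1 1; 0 1)` and `(1 0; 1 1)` is zero. [folklore] -/
theorem eq_zero_of_transvections_mulVec_eq_smul {k : Type*} [Field k] {w : Fin 2 → k} {a b : k}
    (h1 : !![(1 : k), 1; 0, 1] *ᵥ w = a • w) (h2 : !![(1 : k), 0; 1, 1] *ᵥ w = b • w) : w = 0 := by
  have e10 := congrFun h1 0
  have e11 := congrFun h1 1
  have e20 := congrFun h2 0
  have e21 := congrFun h2 1
  simp [Matrix.mulVec, dotProduct, Fin.sum_univ_two] at e10 e11 e20 e21
  have hw1 : w 1 = 0 := by
    by_contra h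
    have ha : a = 1 := by
      by_contra ha; apply h
      have : (a - 1) * w 1 = 0 := by linear_combination e11.symm
      rcases mul_eq_zero.mp this with h' | h'
      · exact absurd (sub_eq_zero.mp h') ha
      · exact h'
    rw [ha, one_mul] at e10
    exact h (by linear_combination e10)
  have hw0 : w 0 = 0 := by
    by_contra h
    have hb : b = 1 := by
      by_contra hb; apply h
      have : (b - 1) * w 0 = 0 := by linear_combination e20.symm
      rcases mul_eq_zero.mp this with h' | h'
      · exact absurd (sub_eq_zero.mp h') hb
      · exact h'
    rw [hb, one_mul] at e21
    exact h (by linear_combination e21)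
  ext i; fin_cases i
  · exact hw0
  · exact hw1

/-- A natural number lies in the finite place `v` of `ℚ` iff the prime under `v` divides it (copy of the
tree's `natCast_mem_asIdeal_iff`, `AbcWave0UniformABCProofs`, to keep imports small). [folklore] -/
theorem natCast_mem_asIdeal_iff_primesEquiv_dvd (v : HeightOneSpectrum (𝓞 ℚ)) (n : ℕ) :
    (n : 𝓞 ℚ) ∈ v.asIdeal ↔ (primesEquiv v : ℕ) ∣ n := by
  change _ ↔ natGenerator v ∣ n
  rw [natGenerator_dvd_iff, Ideal.mem_map_of_equiv]
  constructor
  · intro h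
    exact ⟨n, h, map_natCast _ n⟩
  · rintro ⟨x, hx, hxn⟩
    have : x = n := (Rat.IsIntegralClosure.intEquiv (𝓞 ℚ)).injective (by rw [hxn, map_natCast])
    rwa [this] at hx

end LinearAlgebra

/-! ## §1 Serre's Prop. 12 at `p = 2`: the decomposition group maps onto `GL₂(𝔽₂)` -/

section Serre

/-- **At a good supersingular `2`, `ρ̄_{W,2}(D_𝔓) = GL₂(𝔽₂)` for every `𝔓 ∣ 2`.**  By Serre's Prop. 12 (c),(d)
(named fact `serre1972_supersingular_decompositionSubgroup_image`) the image of the decomposition group has order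
`2·(2² - 1) = 6 = |GL₂(𝔽₂)|`.  Inputs: `GoodSS W 2` (good reduction at `2` and `2 ∣ a₂`, transported to the place
`v` over `2` by `hasGoodReductionAtPrime_primesEquiv_iff_holds`, `LFunction_apply_prime_eq_frobeniusTrace` and
`lFunction_primesEquiv_eq_frobeniusTraceAt`). [cite: SerreInventiones1972, §1.11 Prop. 12 (c),(d); §2.2] -/
theorem map_decompositionSubgroup_eq_top_of_goodSS_two
    (hSe : serre1972_supersingular_decompositionSubgroup_image)
    (W : WeierstrassCurve ℚ) [W.IsElliptic] [W.IsGloballyMinimal] (hss : GoodSS W 2)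
    {ρ : ModPGaloisRep ℚ (ZMod 2) 2} (hρ : W.IsTorsionGaloisRep 2 ρ)
    {v : HeightOneSpectrum (𝓞 ℚ)} (hv : (primesEquiv v : ℕ) = 2)
    {𝔓 : Ideal (absIntegers (𝓞 ℚ) ℚ)} (h𝔓 : 𝔓 ∈ v.primesAbove) :
    (𝔓.decompositionSubgroup (absoluteGaloisGroup ℚ)).map ρ.toMonoidHom = ⊤ := by
  have h2mem : ((2 : ℕ) : 𝓞 ℚ) ∈ v.asIdeal := (natCast_mem_asIdeal_iff_primesEquiv_dvd v 2).mpr (by rw [hv])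
  have hgood : W.HasGoodReductionAt v := (hasGoodReductionAtPrime_primesEquiv_iff_holds W v 2 hv).mp hss.1
  have htr : ((2 : ℕ) : ℤ) ∣ W.frobeniusTraceAt v := by
    have h1 := W.lFunction_primesEquiv_eq_frobeniusTraceAt hgood
    rw [hv, LFunction_apply_prime_eq_frobeniusTrace W 2 hss.1] at h1
    rw [← h1]
    exact hss.2
  obtain ⟨-, -, hD⟩ := hSe W 2 v h2mem hgood htr ρ hρ 𝔓 h𝔓
  exact Subgroup.eq_top_of_card_eq _ (by rw [hD, Literature.Computability.AlgebraicComplexity.card_GL_fin_two_zmod_two]; norm_num)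

end Serre

/-! ## §2 The Galois-side hypotheses of Buzzard's fact at the eigen-ideal, and `hsub` -/

section Buzzard

/-- **`dim_{𝕋/𝔪} J₀(L)[𝔪] = 2` at a mod-`2` eigen-ideal of a good-supersingular-at-`2` curve, from the facts.**
`W/ℚ` globally minimal with `GoodSS W 2`; `L` odd; every prime `p ∤ 2L` good for `W`; `𝔪` a maximal ideal of
`𝕋 = HeckeRing0 L 2` containing `2`, with `|𝕋/𝔪| = 2` and `T_q - a_q(W) ∈ 𝔪` for all primes `q ∤ L`.  Then the
hypotheses of `buzzard2000_multiplicityOne_gamma0` hold with `k = 𝔽̄₂`, `ι : 𝕋/𝔪 ≅ 𝔽₂ → k` and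
`ρ = ρ̄_{W,2} ⊗ k`: unramified with `charpoly ρ(Frob_p) = X² - ι(T_p) X + p` at `p ∤ 2L` (Néron–Ogg–Shafarevich and
`a_p = tr ρ̄(Frob_p)`, `p = det`, reduced mod `2`; `T_p ≡ a_p`), irreducible over `k` and non-scalar on every `D_𝔓`,
`𝔓 ∣ 2` (both because `ρ̄(D_𝔓) = GL₂(𝔽₂)` contains the two transvections, §1); hence `dim_{𝕋/𝔪} J₀(L)[𝔪] = 2`.
[cite: Buzzard2000LevelLoweringModTwo, Prop. 2.4 and Def. 2.1–2.2 (p. 100–101)]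
[cite: SerreInventiones1972, §1.11 Prop. 12 (c),(d)] -/
theorem finrank_torsionBySet_eq_two_of_facts
    (hBz : buzzard2000_multiplicityOne_gamma0)
    (hSe : serre1972_supersingular_decompositionSubgroup_image)
    (W : WeierstrassCurve ℚ) [W.IsElliptic] [W.IsGloballyMinimal] (hss : GoodSS W 2)
    (L : ℕ) [NeZero L] (hL : Odd L)
    (hgood : ∀ v : HeightOneSpectrum (𝓞 ℚ), ¬ ((primesEquiv v : ℕ) ∣ 2 * L) → W.HasGoodReductionAt v)
    (𝔪 : Ideal (HeckeRing0 L 2)) (h𝔪 : 𝔪.IsMaximal) (h2 : (2 : HeckeRing0 L 2) ∈ 𝔪)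
    (hq : Nat.card (HeckeRing0 L 2 ⧸ 𝔪) = 2)
    (hT : ∀ (q : ℕ) (hq : q.Prime), ¬ q ∣ L → HeckeRing0.T L 2 q hq - (W.LFunction q : HeckeRing0 L 2) ∈ 𝔪) :
    Module.finrank (HeckeRing0 L 2 ⧸ 𝔪) (Submodule.torsionBySet (HeckeRing0 L 2) (J0 L) 𝔪) = 2 := by
  classical
  -- the coefficient field `k = 𝔽̄₂` (discrete) and `ι : 𝕋/𝔪 ≅ 𝔽₂ → k`
  let k : Type := AlgebraicClosure (ZMod 2)
  letI : TopologicalSpace k := ⊥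
  haveI : DiscreteTopology k := ⟨rfl⟩
  haveI : Finite (HeckeRing0 L 2 ⧸ 𝔪) := Nat.finite_of_card_ne_zero (by rw [hq]; norm_num)
  letI : Fintype (HeckeRing0 L 2 ⧸ 𝔪) := Fintype.ofFinite _
  have hF : Fintype.card (HeckeRing0 L 2 ⧸ 𝔪) = 2 := by rw [Fintype.card_eq_nat_card, hq]
  let e : ZMod 2 ≃+* HeckeRing0 L 2 ⧸ 𝔪 := ZMod.ringEquivOfPrime _ Nat.prime_two hF
  let f : ZMod 2 →+* k := algebraMap (ZMod 2) k
  let ι : HeckeRing0 L 2 ⧸ 𝔪 →+* k := f.comp e.symm.toRingHom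
  have hι : ∀ a : ℤ, ι (Ideal.Quotient.mk 𝔪 (a : HeckeRing0 L 2)) = (a : k) := fun a ↦ by
    simp only [map_intCast]
  -- the mod-`2` representation of `W` and its base change to `k`
  obtain ⟨ρ₀, hρ₀⟩ := W.exists_isTorsionGaloisRep 2
  let ρ : ModPGaloisRep ℚ k 2 := FramedRep.baseChange f continuous_of_discreteTopology ρ₀
  have hρapp : ∀ σ, ((ρ σ : GL (Fin 2) k) : Matrix (Fin 2) (Fin 2) k) =
      ((ρ₀ σ : GL (Fin 2) (ZMod 2)) : Matrix (Fin 2) (Fin 2) (ZMod 2)).map f := fun σ ↦ rfl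
  -- every element of `GL₂(𝔽₂)` is a `ρ̄(σ)`, `σ ∈ D_𝔓`, for `𝔓 ∣ 2`
  have hmem : ∀ v : HeightOneSpectrum (𝓞 ℚ), ((primesEquiv v : Nat.Primes) : ℕ) = 2 → ∀ 𝔓 ∈ v.primesAbove,
      ∀ g : GL (Fin 2) (ZMod 2), ∃ σ ∈ 𝔓.decompositionSubgroup (absoluteGaloisGroup ℚ), ρ₀ σ = g := by
    intro v hv 𝔓 h𝔓 g
    have hg : g ∈ (𝔓.decompositionSubgroup (absoluteGaloisGroup ℚ)).map ρ₀.toMonoidHom := by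
      rw [map_decompositionSubgroup_eq_top_of_goodSS_two hSe W hss hρ₀ hv h𝔓]; exact Subgroup.mem_top g
    obtain ⟨σ, hσ, hσg⟩ := Subgroup.mem_map.mp hg
    exact ⟨σ, hσ, hσg⟩
  refine hBz L hL 𝔪 h𝔪 h2 k ι ρ ?_ ?_ ?_
  · -- (U) unramified with the Eichler–Shimura characteristic polynomial at `p ∤ 2L`
    intro v hv
    have hp2 : ¬ ((primesEquiv v : Nat.Primes) : ℕ) ∣ 2 := fun h ↦ hv (h.mul_right L)
    have hpL : ¬ ((primesEquiv v : Nat.Primes) : ℕ) ∣ L := fun h ↦ hv (Dvd.dvd.mul_left h 2)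
    have hgoodv : W.HasGoodReductionAt v := hgood v hv
    have h2v : ((2 : ℕ) : 𝓞 ℚ) ∉ v.asIdeal := fun h ↦ hp2 ((natCast_mem_asIdeal_iff_primesEquiv_dvd v 2).mp h)
    refine ⟨?_, ?_⟩
    · intro 𝔓 h𝔓 σ hσ
      have h1 : ρ₀ σ = 1 := hρ₀.isUnramifiedAt_of_hasGoodReductionAt hgoodv h2v 𝔓 h𝔓 σ hσ
      change Matrix.GeneralLinearGroup.map f (ρ₀ σ) = 1
      rw [h1, map_one]
    · intro 𝔓 h𝔓 σ hσ
      have hc := hρ₀.charpoly_eq_of_isArithFrobAt (W.trace_galoisRepTate_frobenius_of_hasGoodReductionAt_holds 2)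
        (W.det_galoisRepTate_frobenius_of_hasGoodReductionAt_holds 2) h2v hgoodv h𝔓 hσ
      have hTp : ι (Ideal.Quotient.mk 𝔪 (HeckeRing0.T L 2 ((primesEquiv v : Nat.Primes) : ℕ) (primesEquiv v).2)) =
          ((W.frobeniusTraceAt v : ℤ) : k) := by
        have hmk : Ideal.Quotient.mk 𝔪 (HeckeRing0.T L 2 ((primesEquiv v : Nat.Primes) : ℕ) (primesEquiv v).2) =
            Ideal.Quotient.mk 𝔪 ((W.LFunction (primesEquiv v : ℕ) : ℤ) : HeckeRing0 L 2) := by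
          rw [Ideal.Quotient.mk_eq_mk_iff_sub_mem]
          exact hT _ (primesEquiv v).2 hpL
        rw [hmk, hι, W.lFunction_primesEquiv_eq_frobeniusTraceAt hgoodv]
      change (((ρ σ : GL (Fin 2) k) : Matrix (Fin 2) (Fin 2) k)).charpoly = _
      rw [hρapp, Matrix.charpoly_map, hc, hTp, natCard_residueField_adicCompletionIntegers v]
      simp only [Polynomial.map_add, Polynomial.map_sub, Polynomial.map_mul, Polynomial.map_pow, Polynomial.map_X,
        Polynomial.map_C]
      rw [map_intCast f, map_natCast f]
  · -- (I) irreducible over `k`: the image contains both transvections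
    let v₂ : HeightOneSpectrum (𝓞 ℚ) := primesEquiv.symm ⟨2, Nat.prime_two⟩
    have hv₂ : ((primesEquiv v₂ : Nat.Primes) : ℕ) = 2 := by
      simp only [v₂, Equiv.apply_symm_apply]
    obtain ⟨𝔓, h𝔓⟩ := HeightOneSpectrum.primesAbove_nonempty v₂
    obtain ⟨T₁, hT₁⟩ := exists_GL_coe_eq_upperTransvection (ZMod 2)
    obtain ⟨T₂, hT₂⟩ := exists_GL_coe_eq_lowerTransvection (ZMod 2)
    obtain ⟨σ₁, -, h₁⟩ := hmem v₂ hv₂ 𝔓 h𝔓 T₁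
    obtain ⟨σ₂, -, h₂⟩ := hmem v₂ hv₂ 𝔓 h𝔓 T₂
    have e₁ : ((ρ σ₁ : GL (Fin 2) k) : Matrix (Fin 2) (Fin 2) k) = !![(1 : k), 1; 0, 1] := by
      rw [hρapp, h₁, hT₁, map_upperTransvection]
    have e₂ : ((ρ σ₂ : GL (Fin 2) k) : Matrix (Fin 2) (Fin 2) k) = !![(1 : k), 0; 1, 1] := by
      rw [hρapp, h₂, hT₂, map_lowerTransvection]
    refine isIrreducible_of_not_hasCommonEigenvector ρ.toMonoidHom ?_
    rintro ⟨w, hw0, hw⟩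
    obtain ⟨a, ha⟩ := hw σ₁
    obtain ⟨b, hb⟩ := hw σ₂
    change ((ρ σ₁ : GL (Fin 2) k) : Matrix (Fin 2) (Fin 2) k) *ᵥ w = a • w at ha
    change ((ρ σ₂ : GL (Fin 2) k) : Matrix (Fin 2) (Fin 2) k) *ᵥ w = b • w at hb
    rw [e₁] at ha
    rw [e₂] at hb
    exact hw0 (eq_zero_of_transvections_mulVec_eq_smul ha hb)
  · -- (S) non-scalar on the decomposition groups at `2`: the image contains `(1 1; 0 1)`
    intro v hv 𝔓 h𝔓
    obtain ⟨T₁, hT₁⟩ := exists_GL_coe_eq_upperTransvection (ZMod 2)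
    obtain ⟨σ, hσ, h⟩ := hmem v hv 𝔓 h𝔓 T₁
    refine ⟨σ, hσ, fun c hc ↦ ?_⟩
    rw [hρapp, h, hT₁, map_upperTransvection] at hc
    have h01 := congrFun (congrFun hc 0) 1
    simp at h01

end Buzzard


/-! ## §3 (K2) at the crux's level from the named facts alone -/

section Glue

/-- **(K2) at the crux's own level, from named facts only (no `hsub`).**  As `StarLevel.kTwo_of_dvd` — `W/ℚ`
globally minimal, `GoodSS W 2`, `Δ_W < 0`, newform `f` of level `N`, `S` a nonempty finite set of primes, a level
`L` with `N·∏_{ℓ∈S} ℓ² ∣ L` and `primes(L) ⊆ S`, `𝔪₀ = span{2, T_q − a_q(W) (q ∤ L), T_ℓ (ℓ ∣ L)}` — plus `L` odd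
and good reduction of `W` at every prime `p ∤ 2L`; the input `hsub` of `kTwo_of_dvd` is now supplied by
`finrank_torsionBySet_eq_two_of_facts` (Buzzard's mod-`2` multiplicity one, whose Galois-side hypotheses are
discharged from Serre's Prop. 12 at the supersingular prime `2`), after the case split `𝔪₀ = ⊤` (vacuous:
`K ⊇ 𝔪₀Λ = Λ`) / `𝔪₀ ≠ ⊤` (then `|𝕋/𝔪₀| = 2`, `𝔪₀` maximal, `StarKTwoOfFacts`).  Conclusion (K2): every additive
`K ⊇ 2Λ, (T_q^∨ − a_q(W))Λ, U_ℓ^∨Λ,` cusp-negation differences has `x, y ∈ Λ ∖ K ⇒ x − y ∈ K`.  Named facts used: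
`eichlerShimura_depletedOptimalQuotient_periodLattice_of_dvd`, `isIsogenous_iff_frobeniusTrace_eq` (Faltings),
`mazurKenku_exists_cyclic_isogeny`, `heckeSelfDual_torsionBy_J0`, `buzzard2000_multiplicityOne_gamma0`,
`serre1972_supersingular_decompositionSubgroup_image`.
[cite: Buzzard2000LevelLoweringModTwo, Prop. 2.4 and Def. 2.1–2.2 (p. 100–101)]
[cite: DarmonDiamondTaylor1995, §1.6 Lemma 1.38 and §4.5 Thm. 4.26] -/
theorem kTwo_of_dvd_of_facts
    (hES : eichlerShimura_depletedOptimalQuotient_periodLattice_of_dvd)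
    (hF : WeierstrassCurve.isIsogenous_iff_frobeniusTrace_eq) (hMK : mazurKenku_exists_cyclic_isogeny)
    (hSD : heckeSelfDual_torsionBy_J0) (hBz : buzzard2000_multiplicityOne_gamma0)
    (hSe : serre1972_supersingular_decompositionSubgroup_image)
    (W : WeierstrassCurve ℚ) [W.IsElliptic] [W.IsGloballyMinimal] (hss : GoodSS W 2) (hΔ : W.Δ < 0)
    {N : ℕ} [NeZero N] {f : CuspForm (Gamma0 N) 2} (hf : IsNewformOf W f)
    (S : Finset ℕ) (hS : ∀ ℓ ∈ S, ℓ.Prime) (hSne : S.Nonempty)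
    (L : ℕ) [NeZero L] (hL : Odd L) (hNL : N * ∏ ℓ ∈ S, ℓ ^ 2 ∣ L) (hLS : ∀ p : ℕ, p.Prime → p ∣ L → p ∈ S)
    (hgood : ∀ v : HeightOneSpectrum (𝓞 ℚ), ¬ ((primesEquiv v : ℕ) ∣ 2 * L) → W.HasGoodReductionAt v)
    (K : AddSubgroup (Module.Dual ℂ (CuspForm (Gamma0 L) 2)))
    (h2K : ∀ x ∈ periodHomology L, (2 : ℂ) • x ∈ K)
    (hTK : ∀ (q : ℕ) (hq : q.Prime), ¬ q ∣ L → ∀ x ∈ periodHomology L,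
      (haveI : NeZero q := ⟨hq.ne_zero⟩; heckeT (Gamma0 L) 2 q).dualMap x - (W.LFunction q : ℂ) • x ∈ K)
    (hUK : ∀ (q : ℕ) (hq : q.Prime), q ∣ L → ∀ x ∈ periodHomology L,
      (haveI : NeZero q := ⟨hq.ne_zero⟩; heckeT (Gamma0 L) 2 q).dualMap x ∈ K)
    (hcK : ∀ γ : Gamma0 L, periodFunctional L ⟨iotaConj (γ : SL(2, ℤ)), iotaConj_coe_mem_gamma0 γ⟩ - periodFunctional L γ ∈ K)
    {x y : Module.Dual ℂ (CuspForm (Gamma0 L) 2)} (hx : x ∈ periodHomology L) (hy : y ∈ periodHomology L)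
    (hxK : x ∉ K) (hyK : y ∉ K) : x - y ∈ K := by
  classical
  set G : Set (HeckeRing0 L 2) := {t : HeckeRing0 L 2 | t = 2 ∨ (∃ (q : ℕ) (hq : q.Prime), ¬ q ∣ L ∧
      t = HeckeRing0.T L 2 q hq - (W.LFunction q : HeckeRing0 L 2)) ∨ (∃ (q : ℕ) (hq : q.Prime), q ∣ L ∧
      t = HeckeRing0.T L 2 q hq)} with hGdef
  by_cases hne : Ideal.span G = ⊤
  · -- vacuous case: `K ⊇ 𝔪₀Λ = Λ ∋ x`
    exfalso
    apply hxK
    have hK𝔪 : ∀ z ∈ Ideal.span G • periodHomologyHecke L, z ∈ K := by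
      refine mem_of_mem_ideal_span_smul G K fun s hs z hz ↦ ?_
      rcases hs with rfl | ⟨q, hq', hqL, rfl⟩ | ⟨q, hq', hqL, rfl⟩
      · have : (2 : HeckeRing0 L 2) • z = (2 : ℂ) • z := by
          rw [show (2 : HeckeRing0 L 2) = ((2 : ℤ) : HeckeRing0 L 2) by norm_num, heckeRing0_intCast_smul, Int.cast_ofNat]
        rw [this]
        exact h2K z hz
      · rw [sub_smul, heckeRing0_T_smul, heckeRing0_intCast_smul]
        exact hTK q hq' hqL z hz
      · rw [heckeRing0_T_smul]
        exact hUK q hq' hqL z hz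
    apply hK𝔪
    rw [hne, Submodule.top_smul]
    exact (mem_periodHomologyHecke L).mpr hx
  · have h2 : (2 : HeckeRing0 L 2) ∈ Ideal.span G := Ideal.subset_span (Or.inl rfl)
    have hq := natCard_quotient_eq_two_of_ne_top (Ideal.span G) h2 (eigenIdeal_T_sub_int_mem W) hne
    haveI h𝔪 : (Ideal.span G).IsMaximal := isMaximal_of_natCard_quotient_eq_two _ hq
    have hT : ∀ (q : ℕ) (hq' : q.Prime), ¬ q ∣ L →
        HeckeRing0.T L 2 q hq' - (W.LFunction q : HeckeRing0 L 2) ∈ Ideal.span G :=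
      fun q hq' hqL ↦ Ideal.subset_span (Or.inr (Or.inl ⟨q, hq', hqL, rfl⟩))
    have hsub := finrank_torsionBySet_eq_two_of_facts hBz hSe W hss L hL hgood (Ideal.span G) h𝔪 h2 hq hT
    exact kTwo_of_dvd hES hF hMK hSD W hss hΔ hf S hS hSne L hNL hLS hsub K h2K hTK hUK hcK hx hy hxK hyK

end Glue

end Summit.BirchSwinnertonDyer.BirchSwinnertonDyer.Theorems.ThetaLayerLambdaCongruenceAtTwo

end
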